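import Literature.NumberTheory.EllipticCurves.UniversalOrdinaryCanonicalSubgroup
import Literature.NumberTheory.EllipticCurves.FormalGroupMultiplicationParityProofs
import HarnessLib

/-!
# The even Weierstrass factor `e⁺(q)` of `[p]` and the reduction of `ξ` (`z²x = ξ(z²)`) for the
# universal ordinary curve (towards Blakestad–Grant 2023, Prop. 7 / eq. (4) — proofs only)

Trunk T-NT-EC (Literature/NumberTheory/EllipticCurves). Blakestad–Grant (Prop. 7 and eq. (4))
use that the `x`-coordinates of the non-zero points of the canonical subgroup `G` of the universal
ordinary curve `𝓔/R̂` are the `(p-1)/2` roots of `D` with `p·D = φ_ψ ∈ R̂[x]`, `φ_ψ ≡ ℓ̃₀ (mod p)`;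
they obtain `φ_ψ` from the division polynomial by Weierstrass preparation. On the formal-group side
(our gloss, after Lubin: finite subgroups of a formal group are cut out by the distinguished factor
of `[p]`, cf. `UniversalOrdinaryCanonicalSubgroup`) the parameters `t(u)`, `u ∈ G - O`, are the
roots of the distinguished factor of `[p](t)/t`. Since `[p]` is ODD and `z²x(z)` is EVEN on
`y² = x³ + A₄x + A₆` (`FormalGroupMultiplicationParityProofs`), everything is a series in
`q = t²`, which halves the degrees: this file produces

* `formalMul_prime_eq_X_mul_expand` — `[p](t) = t·m(t²)`; `formalXMulSq_eq_expand` — `z²x = ξ(z²)`;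
* `isWeierstrassDivisorAt_oddPart` — `m(q)` is a Weierstrass divisor at `(p)` of degree
  `n = (p-1)/2` (`[tᵏ][p] ∈ pR̂` for `k < p`, `[tᵖ][p] ∈ R̂ˣ`, `UniversalOrdinaryCanonicalSubgroup`);
* **`exists_evenWeierstrassFactor`** — `[p](t) = t·e⁺(t²)·v⁺(t²)` with `e⁺ ∈ R̂[q]` distinguished
  of degree `n`, `v⁺ ∈ R̂⟦q⟧ˣ`, `e⁺(0) = p·c` (`c ∈ R̂ˣ`, as `[t¹][p] = p`), and the Weierstrass
  division `ξ = e⁺·Q + w`, `deg w < n`, `w(0) ∈ R̂ˣ` — the data `(g, w) = (e⁺, w)` of the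
  determinant construction of `p·D` in `CanonicalSubgroupNormProofs`.

## Sources

* C. Blakestad, D. Grant, J. Number Theory 249 (2023) (arXiv:1903.02480), Prop. 7 (a), eq. (4),
  Lemma 12.
  [BlakestadGrant2023]
* J. Lubin, Ann. of Math. 85 (1967) (finite subgroups of formal groups ↔ Weierstrass polynomials).
  [folklore]

Pure proof file: no definitions, no named facts.
-/

noncomputable section

open PowerSeries Literature.RingTheory.HenselLemma Literature.RingTheory.AdicTopology
open scoped Polynomial

namespace Literature.NumberTheory.EllipticCurves.UniversalOrdinary

variable (p : ℕ) [Fact p.Prime]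

/-- **`[p](t) = t·m(t²)`**: `[p]_𝓔` is odd (`a₁ = a₃ = 0`, `R̂` torsion-free). [Blakestad–Grant 2023,
§2.1; Silverman AEC IV.2.3] [cite: BlakestadGrant2023, §2.1] -/
theorem formalMul_prime_eq_X_mul_expand (hp5 : 5 ≤ p) :
    (universalCurve p).formalMul p = X * expand 2 two_ne_zero
      (PowerSeries.mk fun k => coeff (2 * k + 1) ((universalCurve p).formalMul p)) := by
  haveI := isAddTorsionFree_completeRing p hp5
  exact eq_X_mul_expand_two_of_rescale_neg_one_eq_neg ((universalCurve p).rescale_neg_one_formalMul p)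

/-- **`z²x(z) = ξ(z²)`**: `X_𝓔` is even. [Silverman AEC IV.1; Blakestad–Grant 2023, §2.1]
[cite: BlakestadGrant2023, §2.1] -/
theorem formalXMulSq_eq_expand (hp5 : 5 ≤ p) :
    (universalCurve p).formalXMulSq = expand 2 two_ne_zero
      (PowerSeries.mk fun k => coeff (2 * k) (universalCurve p).formalXMulSq) := by
  haveI := isAddTorsionFree_completeRing p hp5
  exact eq_expand_two_of_rescale_neg_one_eq_self (universalCurve p).rescale_neg_one_formalXMulSq

/-- **The odd part `m(q)` of `[p]` is a Weierstrass divisor at `(p)` of Weierstrass degree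
`n = (p-1)/2`**: `[qᵏ]m = [t^{2k+1}][p] ∈ pR̂` for `k < n` and `[qⁿ]m = [tᵖ][p] ∈ R̂ˣ`.
[Lubin 1967; Blakestad–Grant 2023, Lemma 12 (the analogous factorisation of `t'`)] [folklore] -/
theorem isWeierstrassDivisorAt_oddPart (hp5 : 5 ≤ p) {n : ℕ} (hnp : 2 * n + 1 = p) :
    (PowerSeries.mk fun k => coeff (2 * k + 1) ((universalCurve p).formalMul p)).IsWeierstrassDivisorAt
        (Ideal.span {(p : completeRing p)}) ∧
      ((PowerSeries.mk fun k => coeff (2 * k + 1) ((universalCurve p).formalMul p)).map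
        (Ideal.Quotient.mk (Ideal.span {(p : completeRing p)}))).order.toNat = n := by
  refine isWeierstrassDivisorAt_of_coeff_mem (fun i hi => ?_) ?_ (span_natCast_isPrime_completeRing p hp5).ne_top
  · rw [coeff_mk]; exact coeff_formalMul_prime_mem_of_lt p (by omega)
  · rw [coeff_mk, hnp]; exact isUnit_coeff_prime_formalMul p hp5

/-- **The even Weierstrass factor of `[p]` and the reduction of `ξ`** (`p ≥ 5`). There are
`n = (p-1)/2`, a distinguished `e⁺ ∈ R̂[q]` of degree `n`, a unit `v⁺ ∈ R̂⟦q⟧`, a unit `c ∈ R̂`,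
series `ξ, Q ∈ R̂⟦q⟧` and a polynomial `w ∈ R̂[q]` of degree `< n` with
`[p](t) = t·e⁺(t²)·v⁺(t²)`, `e⁺(0) = p·c`, `z²x(z) = ξ(z²)`, `ξ(0) = 1`, `ξ = e⁺·Q + w`
(Weierstrass division) and `w(0) ∈ R̂ˣ` (`≡ 1 mod p`). These are the inputs `g = e⁺`, `w` of
`CanonicalSubgroupNormProofs.kernelPolynomial_of_distinguished` (the shape of Blakestad–Grant's
eq. (4) for the kernel polynomial `D` of the canonical subgroup, `deg D = n`). [Blakestad–Grant 2023,
Prop. 7 (a), eq. (4), Lemma 12; Lubin 1967] [cite: BlakestadGrant2023, Prop. 7, eq. (4)] -/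
theorem exists_evenWeierstrassFactor (hp5 : 5 ≤ p) :
    ∃ (n : ℕ) (_ : 2 * n + 1 = p) (e : (completeRing p)[X]) (v : PowerSeries (completeRing p)) (c : completeRing p)
      (ξ Q : PowerSeries (completeRing p)) (w : (completeRing p)[X]),
      e.IsDistinguishedAt (Ideal.span {(p : completeRing p)}) ∧ e.natDegree = n ∧ IsUnit v ∧
      (universalCurve p).formalMul p = X * expand 2 two_ne_zero ((e : PowerSeries (completeRing p)) * v) ∧
      IsUnit c ∧ e.coeff 0 = p * c ∧
      (universalCurve p).formalXMulSq = expand 2 two_ne_zero ξ ∧ constantCoeff ξ = 1 ∧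
      ξ = (e : PowerSeries (completeRing p)) * Q + w ∧ w.degree < n ∧ IsUnit (w.coeff 0) := by
  have hI : Ideal.span {(p : completeRing p)} ≠ ⊤ := (span_natCast_isPrime_completeRing p hp5).ne_top
  obtain ⟨n, hn⟩ := (Fact.out : p.Prime).eq_two_or_odd'.resolve_left (by omega)
  have hnp : 2 * n + 1 = p := hn.symm
  set m : PowerSeries (completeRing p) := PowerSeries.mk fun k => coeff (2 * k + 1) ((universalCurve p).formalMul p)
    with hm
  have hdiv := isWeierstrassDivisorAt_oddPart p hp5 hnp
  obtain ⟨e, v, hfac, hdeg⟩ := exists_isWeierstrassFactorizationAt hdiv.1 hI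
  rw [hdiv.2] at hdeg
  -- `e(0)·v(0) = m(0) = [t¹][p] = p`
  have hm0 : constantCoeff m = p := by
    rw [hm, ← coeff_zero_eq_constantCoeff_apply, coeff_mk, Nat.mul_zero, Nat.zero_add,
      (universalCurve p).coeff_one_formalMul']
  have hvu : IsUnit (constantCoeff v) := isUnit_constantCoeff v hfac.isUnit
  set c : completeRing p := ↑hvu.unit⁻¹ with hc
  have hcv : constantCoeff v * c = 1 := hvu.mul_val_inv
  have he0 : e.coeff 0 = p * c := by
    have h := congrArg constantCoeff hfac.eq_mul
    rw [hm0, map_mul, Polynomial.constantCoeff_coe] at h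
    rw [h, mul_assoc, hcv, mul_one]
  -- the factorisation of `[p]`
  have hmul : (universalCurve p).formalMul p = X * expand 2 two_ne_zero ((e : PowerSeries (completeRing p)) * v) := by
    rw [← hfac.eq_mul]; exact formalMul_prime_eq_X_mul_expand p hp5
  -- `ξ` and its Weierstrass division by `e`
  set ξ : PowerSeries (completeRing p) := PowerSeries.mk fun k => coeff (2 * k) (universalCurve p).formalXMulSq with hξ
  have hXξ : (universalCurve p).formalXMulSq = expand 2 two_ne_zero ξ := formalXMulSq_eq_expand p hp5
  have hξ0 : constantCoeff ξ = 1 := by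
    rw [hξ, ← coeff_zero_eq_constantCoeff_apply, coeff_mk, Nat.mul_zero, coeff_zero_eq_constantCoeff_apply,
      (universalCurve p).constantCoeff_formalXMulSq]
  have hediv : (e : PowerSeries (completeRing p)).IsWeierstrassDivisorAt (Ideal.span {(p : completeRing p)}) ∧
      ((e : PowerSeries (completeRing p)).map (Ideal.Quotient.mk (Ideal.span {(p : completeRing p)}))).order.toNat = n := by
    refine isWeierstrassDivisorAt_of_coeff_mem (fun i hi => ?_) ?_ hI
    · rw [Polynomial.coeff_coe]
      exact hfac.isDistinguishedAt.toIsWeaklyEisensteinAt.mem (by omega)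
    · rw [Polynomial.coeff_coe, ← hdeg, Polynomial.coeff_natDegree, hfac.isDistinguishedAt.monic.leadingCoeff]
      exact isUnit_one
  obtain ⟨hwdeg, hweq⟩ := hediv.1.isWeierstrassDivisionAt_div_mod ξ
  have hwdeg' : (hediv.1.mod ξ).degree < (n : WithBot ℕ) := hwdeg.trans_eq (by rw [hediv.2])
  set Q := hediv.1.div ξ
  set w := hediv.1.mod ξ
  -- `w(0) = 1 - p·c·Q(0)` is a unit of the `p`-adically complete `R̂`
  have hw0 : IsUnit (w.coeff 0) := by
    have h := congrArg constantCoeff hweq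
    rw [hξ0, map_add, map_mul, Polynomial.constantCoeff_coe, Polynomial.constantCoeff_coe, he0] at h
    refine isUnit_of_isUnit_mk (Ideal.span {(p : completeRing p)}) ?_
    have e1 : Ideal.Quotient.mk (Ideal.span {(p : completeRing p)}) (w.coeff 0) = 1 := by
      rw [← map_one (Ideal.Quotient.mk (Ideal.span {(p : completeRing p)})), Ideal.Quotient.eq, Ideal.mem_span_singleton]
      exact ⟨-(c * constantCoeff Q), by linear_combination -h⟩
    rw [e1]; exact isUnit_one
  exact ⟨n, hnp, e, v, c, ξ, Q, w, hfac.isDistinguishedAt, hdeg, hfac.isUnit, hmul, Units.isUnit _, he0, hXξ, hξ0, hweq,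
    hwdeg', hw0⟩

end Literature.NumberTheory.EllipticCurves.UniversalOrdinary
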